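import Literature.AlgebraicGeometry.HodgeTheory.HodgeEndomorphismsHOneOfRiemann
import Literature.AlgebraicGeometry.HodgeTheory.NoTypeIVFactorProducts
import HarnessLib

/-!
# `H¹(A × B; ℚ) = pr₁^* H¹(A) ⊕ pr₂^* H¹(B)` with its `End⁰(A) × End⁰(B)`-action: the characters of `End_Hdg(H¹(A × B))` and their eigenblocks

Family `hodge`, layer `Literature/AlgebraicGeometry/HodgeTheory`. Research context: cell `pub-hodge-ring2`
(HONEST FRAMING: research route conditional on HC_CM; not a corollary; Q11.4-sentence-2 already refuted in
dim ≥ 3), Literature lane, programme R3 bricks B′1/B′3/B′4 (`pub-hodge-ring2-lit-g40/PLAN-R3.md`):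
the geometric bridge from the two factors `A`, `B` to the weight-one Hodge structure `H¹((A × B)(ℂ); ℚ)`
needed to apply the tree's field-free Lie-algebra theorems (`Motives/HodgeLieRealPlacesSl2`) to a PRODUCT
of two real-multiplication varieties (Hazama 1989; Moonen–Zarhin 1999 Thm. (3.2)(1): «Hg(X₁ × X₂) =
Hg(X₁) × Hg(X₂)»). UNCONDITIONAL (`hHD`, `hI` are the tree theorems `exists_isReal_hodgeModel_holds`,
`hodgePQ_independent_of_hodgeModel_holds`); no step towards a summit statement.

## Statements

For complex abelian varieties `A`, `B` with product `A × B = A.prod B` (projections `pr₁ = fst`,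
`pr₂ = snd`; inclusions `ι₁ = inlHom`, `ι₂ = inrHom` through `A ⊞ B ≅ A × B`):
* §1 `inlHom_fst`, `inlHom_snd`, `fst_inlHom_add_snd_inrHom` (`pr₁ ≫ ι₁ + pr₂ ≫ ι₂ = 𝟙`),
  `blockDiag_eq` (`diag(f, g) = pr₁ f ι₁ + pr₂ g ι₂`);
* §2 **Künneth in degree one on `A.prod B`**: `pullInl_comp_pullFst` (`ι₁^* pr₁^* = id`),
  `pullInl_comp_pullSnd` (`ι₁^* pr₂^* = 0`), `pullFst_comp_pullInl_add` (`pr₁^* ι₁^* + pr₂^* ι₂^* = id`),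
  `pullFst_injective`, and the complexified identities;
* §3 **the action of `End⁰(A) × End⁰(B)`**: `unop_bettiRep_inlAlg : (inlAlg x)^* = pr₁^* ∘ x^* ∘ ι₁^*`,
  `unop_bettiRep_inrAlg`, hence `(inlAlg x)^* ∘ pr₁^* = pr₁^* ∘ x^*`, `(inrAlg y)^* ∘ pr₁^* = 0`
  (Lange 2023 Cor. 2.4.26: «End_ℚ(X₁ × X₂) ⊇ End_ℚ(X₁) × End_ℚ(X₂)» acting diagonally on `H¹ = H¹ ⊕ H¹`);
* §4 for COMMUTATIVE `End⁰(A × B)` (e.g. `E₁ × E₂` for orthogonal factors with commutative `End⁰`):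
  `fstAlgRingHom` (the corner `End⁰(A × B) → End⁰(A)` is a ring homomorphism), the characters
  **`prodFstCharacter τ = τ ∘ corner₁ ∘ (End⁰(A × B) ≅ End_Hdg H¹(A × B))⁻¹`** of `End_Hdg(H¹(A × B))`
  attached to characters `τ : End⁰(A) → ℂ` (and `prodSndCharacter`), real when `τ` is;
  **`eigenBlock_prodFstCharacter`: its eigenblock is `pr₁^*(V_τ(A))`**, `V_τ(A) = ⋂_e ker(e^* ⊗ ℂ − τ e)` the
  joint eigenspace of `End⁰(A)` on `H¹(A) ⊗ ℂ`; `finrank_eigenBlock_prodFstCharacter` (same dimension);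
* §5 **`isInternal_eigenBlock_prod`**: if `H¹(A) ⊗ ℂ = ⊕_i V_{τ₁ i}(A)` and `H¹(B) ⊗ ℂ = ⊕_j V_{τ₂ j}(B)` are
  internal direct sums then so is `H¹(A × B) ⊗ ℂ = ⊕_i pr₁^* V_{τ₁ i}(A) ⊕ ⊕_j pr₂^* V_{τ₂ j}(B)` over
  `ι₁ ⊕ ι₂` — the hypothesis `hint` of `HodgeStructure.mem_hodgeLie_iff_commute_and_skew` for the product
  (abstract lattice lemma `HOneProduct.isInternal_sum_elim_map`).
Deligne, *Hodge cycles on abelian varieties* §4 p. 30: `H¹_B ⊗ ℂ = ⊕_σ H¹_{B,σ}`, «`e ∈ E` acts on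
`H¹_{B,σ}` as `σ(e)`»; Hazama 1983 §3 p. 305: `H¹(A, ℂ) = V₁ ⊕ ⋯ ⊕ V_k`.

No named fact; definitions with bodies (`inlHom`, `inrHom`, `pullFst`, `pullSnd`, `pullInl`, `pullInr`,
`fstAlgRingHom`, `sndAlgRingHom`, `prodFstCharacter`, `prodSndCharacter`); axioms standard.

## References

* [VoisinHodgeI2002] C. Voisin, *Hodge Theory and Complex Algebraic Geometry I*, §7.3.2, §11.3.3 Thm. 11.38.
  [cite: VoisinHodgeI2002, §11.3.3 Thm. 11.38]
* [Lange2023AbelianVarietiesC] H. Lange, *Abelian Varieties over the Complex Numbers* (2023), Prop. 1.1.8,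
  Cor. 2.4.26. [cite: Lange2023AbelianVarietiesC, Prop. 1.1.8 and Cor. 2.4.26]
* [Deligne1982HodgeCycles] P. Deligne, *Hodge cycles on abelian varieties*, LNM 900, §4 p. 30.
  [cite: Deligne1982HodgeCycles, §4 p. 30]
* [Hazama1983] F. Hazama, Tôhoku Math. J. 35 (1983), §3 (p. 305). [cite: Hazama1983, §3 (p. 305)]
* [MoonenZarhin1999LowDim] B. Moonen, Yu. Zarhin, Duke Math. J. 98 (1999), Thm. (3.2)(1).
  [cite: MoonenZarhin1999LowDim, §3 (3.2)]
* [HatcherAT2002] A. Hatcher, *Algebraic Topology*, §3.2 Thm. 3.16. [cite: HatcherAT2002, §3.2 Thm. 3.16]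
-/

noncomputable section

open scoped TensorProduct
open CategoryTheory CategoryTheory.Limits Module

namespace Literature.AlgebraicGeometry.HodgeTheory

open Literature.AlgebraicGeometry.Motives Literature.AlgebraicGeometry.ComplexMultiplication
open Literature.AlgebraicGeometry.Motives.HodgeStructure
open Literature.AlgebraicGeometry.Milne1999.CMTypeProducts

namespace HOneProduct

/-! ### §0 An abstract lattice lemma: internal direct sums through a split pair of embeddings -/

/-- **Internal direct sums transported through a biproduct of modules.** If `f : M₁ → M`, `g : M₂ → M`
have retractions `F`, `G` with `F f = id`, `F g = 0`, `G g = id`, `G f = 0`, `f F + g G = id`, and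
`M₁ = ⊕_i U_i`, `M₂ = ⊕_j U'_j` are internal direct sums, then `M = ⊕_i f(U_i) ⊕ ⊕_j g(U'_j)` is an internal
direct sum over `ι₁ ⊕ ι₂`. [cite: HatcherAT2002, §3.2 Thm. 3.16] -/
theorem isInternal_sum_elim_map {R M M₁ M₂ : Type*} [Ring R] [AddCommGroup M] [Module R M]
    [AddCommGroup M₁] [Module R M₁] [AddCommGroup M₂] [Module R M₂] {ι₁ ι₂ : Type*} [DecidableEq ι₁]
    [DecidableEq ι₂] (f : M₁ →ₗ[R] M) (g : M₂ →ₗ[R] M) (F : M →ₗ[R] M₁) (G : M →ₗ[R] M₂)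
    (hFf : ∀ x, F (f x) = x) (hFg : ∀ y, F (g y) = 0) (hGg : ∀ y, G (g y) = y) (hGf : ∀ x, G (f x) = 0)
    (hfg : ∀ v, f (F v) + g (G v) = v) {U : ι₁ → Submodule R M₁} {U' : ι₂ → Submodule R M₂}
    (hU : DirectSum.IsInternal U) (hU' : DirectSum.IsInternal U') :
    DirectSum.IsInternal (Sum.elim (fun i => (U i).map f) (fun j => (U' j).map g)) := by
  set N : ι₁ ⊕ ι₂ → Submodule R M := Sum.elim (fun i => (U i).map f) (fun j => (U' j).map g) with hN
  apply DirectSum.isInternal_submodule_of_iSupIndep_of_iSup_eq_top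
  · intro k
    cases k with
    | inl i =>
      rw [Submodule.disjoint_def]
      intro x hx hx'
      have hle : (⨆ (l) (_ : l ≠ Sum.inl i), N l) ≤ (⨆ (i') (_ : i' ≠ i), U i').map f ⊔ LinearMap.range g := by
        refine iSup₂_le fun l hl => ?_
        cases l with
        | inl i' =>
          have hi' : i' ≠ i := fun h => hl (by rw [h])
          exact le_sup_of_le_left (Submodule.map_mono (le_biSup U hi'))
        | inr j => exact le_sup_of_le_right LinearMap.map_le_range
      have hx1 : x ∈ (U i).map f := hx
      obtain ⟨u, hu, rfl⟩ := Submodule.mem_map.1 hx1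
      obtain ⟨y, hy, z, hz, hyz⟩ := Submodule.mem_sup.1 (hle hx')
      obtain ⟨u', hu', rfl⟩ := Submodule.mem_map.1 hy
      obtain ⟨w, rfl⟩ := LinearMap.mem_range.1 hz
      have hu_eq : u' = u := by
        have h := congrArg F hyz
        rwa [map_add, hFf, hFg, add_zero, hFf] at h
      have h0 : u = 0 := by
        have hmem : u ∈ U i ⊓ ⨆ (i') (_ : i' ≠ i), U i' := Submodule.mem_inf.2 ⟨hu, hu_eq ▸ hu'⟩
        rwa [(hU.submodule_iSupIndep i).eq_bot, Submodule.mem_bot] at hmem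
      rw [h0, map_zero]
    | inr j =>
      rw [Submodule.disjoint_def]
      intro x hx hx'
      have hle : (⨆ (l) (_ : l ≠ Sum.inr j), N l) ≤ LinearMap.range f ⊔ (⨆ (j') (_ : j' ≠ j), U' j').map g := by
        refine iSup₂_le fun l hl => ?_
        cases l with
        | inl i => exact le_sup_of_le_left LinearMap.map_le_range
        | inr j' =>
          have hj' : j' ≠ j := fun h => hl (by rw [h])
          exact le_sup_of_le_right (Submodule.map_mono (le_biSup U' hj'))
      have hx1 : x ∈ (U' j).map g := hx
      obtain ⟨u, hu, rfl⟩ := Submodule.mem_map.1 hx1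
      obtain ⟨y, hy, z, hz, hyz⟩ := Submodule.mem_sup.1 (hle hx')
      obtain ⟨w, rfl⟩ := LinearMap.mem_range.1 hy
      obtain ⟨u', hu', rfl⟩ := Submodule.mem_map.1 hz
      have hu_eq : u' = u := by
        have h := congrArg G hyz
        rwa [map_add, hGf, hGg, zero_add, hGg] at h
      have h0 : u = 0 := by
        have hmem : u ∈ U' j ⊓ ⨆ (j') (_ : j' ≠ j), U' j' := Submodule.mem_inf.2 ⟨hu, hu_eq ▸ hu'⟩
        rwa [(hU'.submodule_iSupIndep j).eq_bot, Submodule.mem_bot] at hmem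
      rw [h0, map_zero]
  · rw [eq_top_iff]
    intro v _
    rw [← hfg v]
    refine Submodule.add_mem _ ?_ ?_
    · have h1 : F v ∈ ⨆ i, U i := by rw [hU.submodule_iSup_eq_top]; exact Submodule.mem_top
      have h2 : (⨆ i, U i).map f ≤ ⨆ k, N k := by
        rw [Submodule.map_iSup]
        exact iSup_le fun i => le_iSup N (Sum.inl i)
      exact h2 (Submodule.mem_map_of_mem h1)
    · have h1 : G v ∈ ⨆ j, U' j := by rw [hU'.submodule_iSup_eq_top]; exact Submodule.mem_top
      have h2 : (⨆ j, U' j).map g ≤ ⨆ k, N k := by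
        rw [Submodule.map_iSup]
        exact iSup_le fun j => le_iSup N (Sum.inr j)
      exact h2 (Submodule.mem_map_of_mem h1)

variable (A B : AbelianVariety ℂ)

/-! ### §1 The inclusions `ι₁`, `ι₂` of the factors and the identities of the product -/

/-- `ι₁ = (𝟙, 0) : A → A × B` (through the biproduct isomorphism `A ⊞ B ≅ A × B`).
[cite: Lange2023AbelianVarietiesC, Cor. 2.4.26] -/
def inlHom : A ⟶ A.prod B := biprod.inl ≫ (AbelianVariety.biprodIsoProd A B).hom

/-- `ι₂ = (0, 𝟙) : B → A × B`. [cite: Lange2023AbelianVarietiesC, Cor. 2.4.26] -/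
def inrHom : B ⟶ A.prod B := biprod.inr ≫ (AbelianVariety.biprodIsoProd A B).hom

/-- `pr₁ = e⁻¹ ≫ biprod.fst`. [cite: Lange2023AbelianVarietiesC, Cor. 2.4.26] -/
theorem fst_eq : AbelianVariety.fst A B = (AbelianVariety.biprodIsoProd A B).inv ≫ biprod.fst := by
  rw [← AbelianVariety.biprodIsoProd_hom_fst, Iso.inv_hom_id_assoc]

/-- `pr₂ = e⁻¹ ≫ biprod.snd`. [cite: Lange2023AbelianVarietiesC, Cor. 2.4.26] -/
theorem snd_eq : AbelianVariety.snd A B = (AbelianVariety.biprodIsoProd A B).inv ≫ biprod.snd := by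
  rw [← AbelianVariety.biprodIsoProd_hom_snd, Iso.inv_hom_id_assoc]

/-- `ι₁ ≫ pr₁ = 𝟙`. [cite: Lange2023AbelianVarietiesC, Cor. 2.4.26] -/
@[simp]
theorem inlHom_fst : inlHom A B ≫ AbelianVariety.fst A B = 𝟙 A := by
  rw [inlHom, Category.assoc, AbelianVariety.biprodIsoProd_hom_fst, biprod.inl_fst]

/-- `ι₁ ≫ pr₂ = 0`. [cite: Lange2023AbelianVarietiesC, Cor. 2.4.26] -/
@[simp]
theorem inlHom_snd : inlHom A B ≫ AbelianVariety.snd A B = 0 := by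
  rw [inlHom, Category.assoc, AbelianVariety.biprodIsoProd_hom_snd, biprod.inl_snd]

/-- `ι₂ ≫ pr₂ = 𝟙`. [cite: Lange2023AbelianVarietiesC, Cor. 2.4.26] -/
@[simp]
theorem inrHom_snd : inrHom A B ≫ AbelianVariety.snd A B = 𝟙 B := by
  rw [inrHom, Category.assoc, AbelianVariety.biprodIsoProd_hom_snd, biprod.inr_snd]

/-- `ι₂ ≫ pr₁ = 0`. [cite: Lange2023AbelianVarietiesC, Cor. 2.4.26] -/
@[simp]
theorem inrHom_fst : inrHom A B ≫ AbelianVariety.fst A B = 0 := by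
  rw [inrHom, Category.assoc, AbelianVariety.biprodIsoProd_hom_fst, biprod.inr_fst]

/-- `pr₁ ≫ ι₁ + pr₂ ≫ ι₂ = 𝟙 (A × B)`. [cite: Lange2023AbelianVarietiesC, Cor. 2.4.26] -/
theorem fst_inlHom_add_snd_inrHom :
    AbelianVariety.fst A B ≫ inlHom A B + AbelianVariety.snd A B ≫ inrHom A B = 𝟙 (A.prod B) := by
  rw [fst_eq, snd_eq, inlHom, inrHom, Category.assoc, Category.assoc, ← Preadditive.comp_add,
    ← Category.assoc biprod.fst, ← Category.assoc biprod.snd, ← Preadditive.add_comp, biprod.total,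
    Category.id_comp, Iso.inv_hom_id]

/-- `diag(f, g) = pr₁ ≫ f ≫ ι₁ + pr₂ ≫ g ≫ ι₂`. [cite: Lange2023AbelianVarietiesC, Cor. 2.4.26] -/
theorem blockDiag_eq (f : A ⟶ A) (g : B ⟶ B) :
    blockDiag A B f g =
      AbelianVariety.fst A B ≫ f ≫ inlHom A B + AbelianVariety.snd A B ≫ g ≫ inrHom A B := by
  rw [blockDiag, biprod.map_eq, Preadditive.add_comp, Preadditive.comp_add, fst_eq, snd_eq, inlHom, inrHom]
  simp only [Category.assoc]

/-! ### §2 Künneth in degree one on `A.prod B` -/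

/-- `pr₁^* : H¹(A(ℂ); ℚ) → H¹((A × B)(ℂ); ℚ)`. [cite: VoisinHodgeI2002, §11.3.3 Thm. 11.38] -/
abbrev pullFst : bettiCohomology A.X 1 →ₗ[ℚ] bettiCohomology (A.prod B).X 1 :=
  BettiUniverse.pull (AbelianVariety.fst A B).hom.hom.hom 1

/-- `pr₂^* : H¹(B(ℂ); ℚ) → H¹((A × B)(ℂ); ℚ)`. [cite: VoisinHodgeI2002, §11.3.3 Thm. 11.38] -/
abbrev pullSnd : bettiCohomology B.X 1 →ₗ[ℚ] bettiCohomology (A.prod B).X 1 :=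
  BettiUniverse.pull (AbelianVariety.snd A B).hom.hom.hom 1

/-- `ι₁^* : H¹((A × B)(ℂ); ℚ) → H¹(A(ℂ); ℚ)`. [cite: VoisinHodgeI2002, §11.3.3 Thm. 11.38] -/
abbrev pullInl : bettiCohomology (A.prod B).X 1 →ₗ[ℚ] bettiCohomology A.X 1 :=
  BettiUniverse.pull (inlHom A B).hom.hom.hom 1

/-- `ι₂^* : H¹((A × B)(ℂ); ℚ) → H¹(B(ℂ); ℚ)`. [cite: VoisinHodgeI2002, §11.3.3 Thm. 11.38] -/
abbrev pullInr : bettiCohomology (A.prod B).X 1 →ₗ[ℚ] bettiCohomology B.X 1 :=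
  BettiUniverse.pull (inrHom A B).hom.hom.hom 1

variable {A B}

/-- `(f ≫ g)^* = f^* ∘ g^*` on `H¹`. [folklore] -/
private theorem pull_comp {X Y Z : AbelianVariety ℂ} (f : X ⟶ Y) (g : Y ⟶ Z) :
    BettiUniverse.pull (f ≫ g).hom.hom.hom 1 =
      BettiUniverse.pull f.hom.hom.hom 1 ∘ₗ BettiUniverse.pull g.hom.hom.hom 1 := by
  change (bettiCohomology.map (f ≫ g).hom.hom.hom 1).hom = _
  rw [bettiCohomology_map_comp_hom, ModuleCat.hom_comp]

/-- `𝟙^* = id` on `H¹`. [folklore] -/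
private theorem pull_id' (X : AbelianVariety ℂ) :
    BettiUniverse.pull (𝟙 X : X ⟶ X).hom.hom.hom 1 = LinearMap.id := by
  change (bettiCohomology.map (𝟙 X : X ⟶ X).hom.hom.hom 1).hom = _
  rw [bettiCohomology_map_id_hom, ModuleCat.hom_id]

/-- `0^* = 0` on `H¹`. [folklore] -/
private theorem pull_zero' (X Y : AbelianVariety ℂ) :
    BettiUniverse.pull (0 : X ⟶ Y).hom.hom.hom 1 = 0 := by
  change (bettiCohomology.map (0 : X ⟶ Y).hom.hom.hom 1).hom = _
  rw [bettiCohomology_map_zero_one, ModuleCat.hom_zero]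

/-- `(f + g)^* = f^* + g^*` on `H¹`. [folklore] -/
private theorem pull_add' {X Y : AbelianVariety ℂ} (f g : X ⟶ Y) :
    BettiUniverse.pull (f + g).hom.hom.hom 1 =
      BettiUniverse.pull f.hom.hom.hom 1 + BettiUniverse.pull g.hom.hom.hom 1 := by
  change (bettiCohomology.map (f + g).hom.hom.hom 1).hom = _
  rw [bettiCohomology_map_add_one, ModuleCat.hom_add]

/-- `ι₁^* ∘ pr₁^* = id`. [cite: VoisinHodgeI2002, §11.3.3 Thm. 11.38] [cite: HatcherAT2002, §3.2 Thm. 3.16] -/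
theorem pullInl_comp_pullFst : pullInl A B ∘ₗ pullFst A B = LinearMap.id := by
  rw [pullInl, pullFst, ← pull_comp, inlHom_fst, pull_id']

/-- `ι₁^* ∘ pr₂^* = 0`. [cite: VoisinHodgeI2002, §11.3.3 Thm. 11.38] [cite: HatcherAT2002, §3.2 Thm. 3.16] -/
theorem pullInl_comp_pullSnd : pullInl A B ∘ₗ pullSnd A B = 0 := by
  rw [pullInl, pullSnd, ← pull_comp, inlHom_snd, pull_zero']

/-- `ι₂^* ∘ pr₂^* = id`. [cite: VoisinHodgeI2002, §11.3.3 Thm. 11.38] [cite: HatcherAT2002, §3.2 Thm. 3.16] -/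
theorem pullInr_comp_pullSnd : pullInr A B ∘ₗ pullSnd A B = LinearMap.id := by
  rw [pullInr, pullSnd, ← pull_comp, inrHom_snd, pull_id']

/-- `ι₂^* ∘ pr₁^* = 0`. [cite: VoisinHodgeI2002, §11.3.3 Thm. 11.38] [cite: HatcherAT2002, §3.2 Thm. 3.16] -/
theorem pullInr_comp_pullFst : pullInr A B ∘ₗ pullFst A B = 0 := by
  rw [pullInr, pullFst, ← pull_comp, inrHom_fst, pull_zero']

/-- **`pr₁^* ι₁^* + pr₂^* ι₂^* = id` on `H¹((A × B)(ℂ); ℚ)`** (Künneth in degree one: every class is the sum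
of its two pulled-back components). [cite: VoisinHodgeI2002, §11.3.3 Thm. 11.38] [cite: HatcherAT2002, §3.2 Thm. 3.16] -/
theorem pullFst_comp_pullInl_add : pullFst A B ∘ₗ pullInl A B + pullSnd A B ∘ₗ pullInr A B = LinearMap.id := by
  rw [pullFst, pullInl, pullSnd, pullInr, ← pull_comp, ← pull_comp, ← pull_add', fst_inlHom_add_snd_inrHom,
    pull_id']

/-- `ι₁^* (pr₁^* x) = x`. [cite: VoisinHodgeI2002, §11.3.3 Thm. 11.38] -/
@[simp]
theorem pullInl_pullFst (x : bettiCohomology A.X 1) : pullInl A B (pullFst A B x) = x := by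
  rw [← LinearMap.comp_apply, pullInl_comp_pullFst, LinearMap.id_apply]

/-- `ι₁^* (pr₂^* y) = 0`. [cite: VoisinHodgeI2002, §11.3.3 Thm. 11.38] -/
@[simp]
theorem pullInl_pullSnd (y : bettiCohomology B.X 1) : pullInl A B (pullSnd A B y) = 0 := by
  rw [← LinearMap.comp_apply, pullInl_comp_pullSnd, LinearMap.zero_apply]

/-- `ι₂^* (pr₂^* y) = y`. [cite: VoisinHodgeI2002, §11.3.3 Thm. 11.38] -/
@[simp]
theorem pullInr_pullSnd (y : bettiCohomology B.X 1) : pullInr A B (pullSnd A B y) = y := by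
  rw [← LinearMap.comp_apply, pullInr_comp_pullSnd, LinearMap.id_apply]

/-- `ι₂^* (pr₁^* x) = 0`. [cite: VoisinHodgeI2002, §11.3.3 Thm. 11.38] -/
@[simp]
theorem pullInr_pullFst (x : bettiCohomology A.X 1) : pullInr A B (pullFst A B x) = 0 := by
  rw [← LinearMap.comp_apply, pullInr_comp_pullFst, LinearMap.zero_apply]

/-- `pr₁^* (ι₁^* v) + pr₂^* (ι₂^* v) = v`. [cite: VoisinHodgeI2002, §11.3.3 Thm. 11.38] -/
theorem pullFst_pullInl_add (v : bettiCohomology (A.prod B).X 1) :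
    pullFst A B (pullInl A B v) + pullSnd A B (pullInr A B v) = v := by
  have h := LinearMap.congr_fun (pullFst_comp_pullInl_add (A := A) (B := B)) v
  rwa [LinearMap.add_apply, LinearMap.comp_apply, LinearMap.comp_apply, LinearMap.id_apply] at h

/-- `pr₁^*` is injective on `H¹`. [cite: VoisinHodgeI2002, §11.3.3 Thm. 11.38] -/
theorem pullFst_injective : Function.Injective (pullFst A B) :=
  Function.LeftInverse.injective (g := pullInl A B) pullInl_pullFst

/-- `pr₂^*` is injective on `H¹`. [cite: VoisinHodgeI2002, §11.3.3 Thm. 11.38] -/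
theorem pullSnd_injective : Function.Injective (pullSnd A B) :=
  Function.LeftInverse.injective (g := pullInr A B) pullInr_pullSnd

/-- Complexified: `ι₁^* (pr₁^* x) = x` on `H¹ ⊗ ℂ`. [cite: VoisinHodgeI2002, §11.3.3 Thm. 11.38] -/
@[simp]
theorem pullInl_pullFst_baseChange (x : ℂ ⊗[ℚ] bettiCohomology A.X 1) :
    (pullInl A B).baseChange ℂ ((pullFst A B).baseChange ℂ x) = x := by
  rw [← LinearMap.comp_apply, ← LinearMap.baseChange_comp, pullInl_comp_pullFst, LinearMap.baseChange_id,
    LinearMap.id_apply]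

/-- Complexified: `ι₁^* (pr₂^* y) = 0`. [cite: VoisinHodgeI2002, §11.3.3 Thm. 11.38] -/
@[simp]
theorem pullInl_pullSnd_baseChange (y : ℂ ⊗[ℚ] bettiCohomology B.X 1) :
    (pullInl A B).baseChange ℂ ((pullSnd A B).baseChange ℂ y) = 0 := by
  rw [← LinearMap.comp_apply, ← LinearMap.baseChange_comp, pullInl_comp_pullSnd, LinearMap.baseChange_zero,
    LinearMap.zero_apply]

/-- Complexified: `ι₂^* (pr₂^* y) = y`. [cite: VoisinHodgeI2002, §11.3.3 Thm. 11.38] -/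
@[simp]
theorem pullInr_pullSnd_baseChange (y : ℂ ⊗[ℚ] bettiCohomology B.X 1) :
    (pullInr A B).baseChange ℂ ((pullSnd A B).baseChange ℂ y) = y := by
  rw [← LinearMap.comp_apply, ← LinearMap.baseChange_comp, pullInr_comp_pullSnd, LinearMap.baseChange_id,
    LinearMap.id_apply]

/-- Complexified: `ι₂^* (pr₁^* x) = 0`. [cite: VoisinHodgeI2002, §11.3.3 Thm. 11.38] -/
@[simp]
theorem pullInr_pullFst_baseChange (x : ℂ ⊗[ℚ] bettiCohomology A.X 1) :
    (pullInr A B).baseChange ℂ ((pullFst A B).baseChange ℂ x) = 0 := by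
  rw [← LinearMap.comp_apply, ← LinearMap.baseChange_comp, pullInr_comp_pullFst, LinearMap.baseChange_zero,
    LinearMap.zero_apply]

/-- Complexified Künneth: `pr₁^* (ι₁^* v) + pr₂^* (ι₂^* v) = v` on `H¹ ⊗ ℂ`. [cite: VoisinHodgeI2002, §11.3.3 Thm. 11.38] -/
theorem pullFst_pullInl_add_baseChange (v : ℂ ⊗[ℚ] bettiCohomology (A.prod B).X 1) :
    (pullFst A B).baseChange ℂ ((pullInl A B).baseChange ℂ v) +
      (pullSnd A B).baseChange ℂ ((pullInr A B).baseChange ℂ v) = v := by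
  have h := congrArg (fun f : bettiCohomology (A.prod B).X 1 →ₗ[ℚ] bettiCohomology (A.prod B).X 1 =>
    f.baseChange ℂ v) (pullFst_comp_pullInl_add (A := A) (B := B))
  simp only [LinearMap.baseChange_add, LinearMap.baseChange_comp, LinearMap.baseChange_id, LinearMap.add_apply,
    LinearMap.comp_apply, LinearMap.id_apply] at h
  exact h

/-- `pr₁^* ⊗ ℂ` is injective. [cite: VoisinHodgeI2002, §11.3.3 Thm. 11.38] -/
theorem pullFst_baseChange_injective : Function.Injective ((pullFst A B).baseChange ℂ) :=
  Function.LeftInverse.injective (g := (pullInl A B).baseChange ℂ) pullInl_pullFst_baseChange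

/-- `pr₂^* ⊗ ℂ` is injective. [cite: VoisinHodgeI2002, §11.3.3 Thm. 11.38] -/
theorem pullSnd_baseChange_injective : Function.Injective ((pullSnd A B).baseChange ℂ) :=
  Function.LeftInverse.injective (g := (pullInr A B).baseChange ℂ) pullInr_pullSnd_baseChange

/-! ### §3 The action of `End⁰(A) × End⁰(B)` on `H¹((A × B)(ℂ); ℚ)` -/

/-- `diag(f, g)^* = pr₁^* f^* ι₁^* + pr₂^* g^* ι₂^*`. [cite: Lange2023AbelianVarietiesC, Prop. 1.1.8 and Cor. 2.4.26] -/
theorem pull_blockDiag (f : A ⟶ A) (g : B ⟶ B) :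
    BettiUniverse.pull (blockDiag A B f g).hom.hom.hom 1 =
      pullFst A B ∘ₗ BettiUniverse.pull f.hom.hom.hom 1 ∘ₗ pullInl A B +
        pullSnd A B ∘ₗ BettiUniverse.pull g.hom.hom.hom 1 ∘ₗ pullInr A B := by
  rw [blockDiag_eq, pull_add', pull_comp, pull_comp, pull_comp, pull_comp]

/-- `(q · (1 ⊗ h))^* = q · h^*` for the rational representation. [cite: Lange2023AbelianVarietiesC, Prop. 1.1.8] -/
private theorem unop_bettiRep_gen (X : AbelianVariety ℂ) (c : ℚ) (h : End X) :
    MulOpposite.unop (bettiRep X (algebraMap ℚ _ c * AbelianVariety.endAlgebra.of X h)) =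
      c • BettiUniverse.pull h.hom.hom.hom 1 := by
  rw [map_mul, AlgHom.commutes, bettiRep_of, Algebra.algebraMap_eq_smul_one, smul_mul_assoc, one_mul,
    MulOpposite.unop_smul, MulOpposite.unop_op]

/-- **`(inlAlg x)^* = pr₁^* ∘ x^* ∘ ι₁^*`**: the endomorphism `(x, 0)` of `A × B` acts on `H¹(A × B)` through the
first Künneth summand. [cite: Lange2023AbelianVarietiesC, Prop. 1.1.8 and Cor. 2.4.26] -/
theorem unop_bettiRep_inlAlg (x : A.endAlgebra) :
    MulOpposite.unop (bettiRep (A.prod B) (inlAlg A B x)) =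
      pullFst A B ∘ₗ MulOpposite.unop (bettiRep A x) ∘ₗ pullInl A B := by
  obtain ⟨M, F, -, hF⟩ := AbelianVariety.endAlgebra.exists_eq_algebraMap_mul_of x
  rw [hF, inlAlg_gen, unop_bettiRep_gen, unop_bettiRep_gen, LinearMap.smul_comp, LinearMap.comp_smul]
  change (M : ℚ)⁻¹ • BettiUniverse.pull (blockDiag A B F 0).hom.hom.hom 1 = _
  rw [pull_blockDiag, pull_zero', LinearMap.zero_comp, LinearMap.comp_zero, add_zero]

/-- **`(inrAlg y)^* = pr₂^* ∘ y^* ∘ ι₂^*`**. [cite: Lange2023AbelianVarietiesC, Prop. 1.1.8 and Cor. 2.4.26] -/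
theorem unop_bettiRep_inrAlg (y : B.endAlgebra) :
    MulOpposite.unop (bettiRep (A.prod B) (inrAlg A B y)) =
      pullSnd A B ∘ₗ MulOpposite.unop (bettiRep B y) ∘ₗ pullInr A B := by
  obtain ⟨M, G, -, hG⟩ := AbelianVariety.endAlgebra.exists_eq_algebraMap_mul_of y
  rw [hG, inrAlg_gen, unop_bettiRep_gen, unop_bettiRep_gen, LinearMap.smul_comp, LinearMap.comp_smul]
  change (M : ℚ)⁻¹ • BettiUniverse.pull (blockDiag A B 0 G).hom.hom.hom 1 = _
  rw [pull_blockDiag, pull_zero', LinearMap.zero_comp, LinearMap.comp_zero, zero_add]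

/-- `(inlAlg x)^* (pr₁^* v) = pr₁^* (x^* v)` (complexified). [cite: Deligne1982HodgeCycles, §4 p. 30] -/
theorem unop_bettiRep_inlAlg_baseChange_pullFst (x : A.endAlgebra) (v : ℂ ⊗[ℚ] bettiCohomology A.X 1) :
    (MulOpposite.unop (bettiRep (A.prod B) (inlAlg A B x))).baseChange ℂ ((pullFst A B).baseChange ℂ v) =
      (pullFst A B).baseChange ℂ ((MulOpposite.unop (bettiRep A x)).baseChange ℂ v) := by
  rw [unop_bettiRep_inlAlg, LinearMap.baseChange_comp, LinearMap.baseChange_comp, LinearMap.comp_apply,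
    LinearMap.comp_apply, pullInl_pullFst_baseChange]

/-- `(inrAlg y)^* (pr₁^* v) = 0` (complexified). [cite: Deligne1982HodgeCycles, §4 p. 30] -/
theorem unop_bettiRep_inrAlg_baseChange_pullFst (y : B.endAlgebra) (v : ℂ ⊗[ℚ] bettiCohomology A.X 1) :
    (MulOpposite.unop (bettiRep (A.prod B) (inrAlg A B y))).baseChange ℂ ((pullFst A B).baseChange ℂ v) = 0 := by
  rw [unop_bettiRep_inrAlg, LinearMap.baseChange_comp, LinearMap.baseChange_comp, LinearMap.comp_apply,
    LinearMap.comp_apply, pullInr_pullFst_baseChange, map_zero, map_zero]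

/-- `(inrAlg y)^* (pr₂^* w) = pr₂^* (y^* w)` (complexified). [cite: Deligne1982HodgeCycles, §4 p. 30] -/
theorem unop_bettiRep_inrAlg_baseChange_pullSnd (y : B.endAlgebra) (w : ℂ ⊗[ℚ] bettiCohomology B.X 1) :
    (MulOpposite.unop (bettiRep (A.prod B) (inrAlg A B y))).baseChange ℂ ((pullSnd A B).baseChange ℂ w) =
      (pullSnd A B).baseChange ℂ ((MulOpposite.unop (bettiRep B y)).baseChange ℂ w) := by
  rw [unop_bettiRep_inrAlg, LinearMap.baseChange_comp, LinearMap.baseChange_comp, LinearMap.comp_apply,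
    LinearMap.comp_apply, pullInr_pullSnd_baseChange]

/-- `(inlAlg x)^* (pr₂^* w) = 0` (complexified). [cite: Deligne1982HodgeCycles, §4 p. 30] -/
theorem unop_bettiRep_inlAlg_baseChange_pullSnd (x : A.endAlgebra) (w : ℂ ⊗[ℚ] bettiCohomology B.X 1) :
    (MulOpposite.unop (bettiRep (A.prod B) (inlAlg A B x))).baseChange ℂ ((pullSnd A B).baseChange ℂ w) = 0 := by
  rw [unop_bettiRep_inlAlg, LinearMap.baseChange_comp, LinearMap.baseChange_comp, LinearMap.comp_apply,
    LinearMap.comp_apply, pullInl_pullSnd_baseChange, map_zero, map_zero]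

/-! ### §4 Commutative `End⁰(A × B)`: the corner ring homomorphisms, the characters and their eigenblocks -/

/-- In a commutative `End⁰(A × B)` every element is central. [folklore] -/
private theorem mem_center_of_comm (hc : ∀ x y : (A.prod B).endAlgebra, x * y = y * x)
    (z : (A.prod B).endAlgebra) : z ∈ Subalgebra.center ℚ (A.prod B).endAlgebra :=
  Subalgebra.mem_center_iff.2 fun b => hc b z

variable (A B) in
/-- **The corner `End⁰(A × B) → End⁰(A)`, `z ↦ ι₁ z pr₁`, is a ring homomorphism when `End⁰(A × B)` is
commutative** (every element is then block-diagonal, `NoTypeIVFactorProducts.eq_prodEndAlgebraHom_of_mem_center`).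
[cite: Lange2023AbelianVarietiesC, Cor. 2.4.26] -/
def fstAlgRingHom (hc : ∀ x y : (A.prod B).endAlgebra, x * y = y * x) :
    (A.prod B).endAlgebra →+* A.endAlgebra where
  toFun := fstAlg A B
  map_one' := by
    rw [← prodEndAlgebraMap_one (A := A) (B := B), fstAlg_prodEndAlgebraMap, Prod.fst_one]
  map_mul' z z' := NoTypeIVFactorProducts.fstAlg_mul_of_mem_center z (mem_center_of_comm hc z')
  map_zero' := map_zero _
  map_add' := map_add _

variable (A B) in
/-- The corner `End⁰(A × B) → End⁰(B)` as a ring homomorphism (commutative case).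
[cite: Lange2023AbelianVarietiesC, Cor. 2.4.26] -/
def sndAlgRingHom (hc : ∀ x y : (A.prod B).endAlgebra, x * y = y * x) :
    (A.prod B).endAlgebra →+* B.endAlgebra where
  toFun := sndAlg A B
  map_one' := by
    rw [← prodEndAlgebraMap_one (A := A) (B := B), sndAlg_prodEndAlgebraMap, Prod.snd_one]
  map_mul' z z' := NoTypeIVFactorProducts.sndAlg_mul_of_mem_center z (mem_center_of_comm hc z')
  map_zero' := map_zero _
  map_add' := map_add _

/-- Unfolding. [cite: Lange2023AbelianVarietiesC, Cor. 2.4.26] -/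
@[simp]
theorem fstAlgRingHom_apply (hc : ∀ x y : (A.prod B).endAlgebra, x * y = y * x) (z : (A.prod B).endAlgebra) :
    fstAlgRingHom A B hc z = fstAlg A B z := rfl

/-- Unfolding. [cite: Lange2023AbelianVarietiesC, Cor. 2.4.26] -/
@[simp]
theorem sndAlgRingHom_apply (hc : ∀ x y : (A.prod B).endAlgebra, x * y = y * x) (z : (A.prod B).endAlgebra) :
    sndAlgRingHom A B hc z = sndAlg A B z := rfl

variable (A B) in
/-- **The character of `End_Hdg(H¹(A × B))` attached to a character `τ` of `End⁰(A)`**: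
`End_Hdg(H¹(A × B)) ≅ End⁰(A × B) —corner₁→ End⁰(A) —τ→ ℂ` (commutative `End⁰(A × B)`).
[cite: Deligne1982HodgeCycles, §4 p. 30] -/
def prodFstCharacter (hHD : exists_isReal_hodgeModel) (hI : hodgePQ_independent_of_hodgeModel)
    (hc : ∀ x y : (A.prod B).endAlgebra, x * y = y * x) (τ : A.endAlgebra →+* ℂ) :
    (BettiUniverse.hodge hHD (AbelianVariety.isSmoothProjective_holds (A := A.prod B)) 1).endAlg →+* ℂ :=
  (τ.comp (fstAlgRingHom A B hc)).comp (endAlgebraAlgEquivEndAlgOfComm hc hHD hI).symm.toRingEquiv.toRingHom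

variable (A B) in
/-- The character of `End_Hdg(H¹(A × B))` attached to a character `τ` of `End⁰(B)`.
[cite: Deligne1982HodgeCycles, §4 p. 30] -/
def prodSndCharacter (hHD : exists_isReal_hodgeModel) (hI : hodgePQ_independent_of_hodgeModel)
    (hc : ∀ x y : (A.prod B).endAlgebra, x * y = y * x) (τ : B.endAlgebra →+* ℂ) :
    (BettiUniverse.hodge hHD (AbelianVariety.isSmoothProjective_holds (A := A.prod B)) 1).endAlg →+* ℂ :=
  (τ.comp (sndAlgRingHom A B hc)).comp (endAlgebraAlgEquivEndAlgOfComm hc hHD hI).symm.toRingEquiv.toRingHom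

/-- `prodFstCharacter τ (z^*) = τ (corner₁ z)`. [cite: Deligne1982HodgeCycles, §4 p. 30] -/
@[simp]
theorem prodFstCharacter_apply (hHD : exists_isReal_hodgeModel) (hI : hodgePQ_independent_of_hodgeModel)
    (hc : ∀ x y : (A.prod B).endAlgebra, x * y = y * x) (τ : A.endAlgebra →+* ℂ)
    (z : (A.prod B).endAlgebra) :
    prodFstCharacter A B hHD hI hc τ (endAlgebraAlgEquivEndAlgOfComm hc hHD hI z) = τ (fstAlg A B z) := by
  show τ (fstAlg A B ((endAlgebraAlgEquivEndAlgOfComm hc hHD hI).symm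
    (endAlgebraAlgEquivEndAlgOfComm hc hHD hI z))) = _
  rw [AlgEquiv.symm_apply_apply]

/-- `prodSndCharacter τ (z^*) = τ (corner₂ z)`. [cite: Deligne1982HodgeCycles, §4 p. 30] -/
@[simp]
theorem prodSndCharacter_apply (hHD : exists_isReal_hodgeModel) (hI : hodgePQ_independent_of_hodgeModel)
    (hc : ∀ x y : (A.prod B).endAlgebra, x * y = y * x) (τ : B.endAlgebra →+* ℂ)
    (z : (A.prod B).endAlgebra) :
    prodSndCharacter A B hHD hI hc τ (endAlgebraAlgEquivEndAlgOfComm hc hHD hI z) = τ (sndAlg A B z) := by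
  show τ (sndAlg A B ((endAlgebraAlgEquivEndAlgOfComm hc hHD hI).symm
    (endAlgebraAlgEquivEndAlgOfComm hc hHD hI z))) = _
  rw [AlgEquiv.symm_apply_apply]

/-- A real `τ` gives a real `prodFstCharacter τ`. [cite: Hazama1983, §3 (p. 305)] -/
theorem prodFstCharacter_isReal (hHD : exists_isReal_hodgeModel) (hI : hodgePQ_independent_of_hodgeModel)
    (hc : ∀ x y : (A.prod B).endAlgebra, x * y = y * x) {τ : A.endAlgebra →+* ℂ}
    (hτ : (starRingEnd ℂ).comp τ = τ) :
    (starRingEnd ℂ).comp (prodFstCharacter A B hHD hI hc τ) = prodFstCharacter A B hHD hI hc τ := by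
  ext a
  obtain ⟨z, rfl⟩ := (endAlgebraAlgEquivEndAlgOfComm hc hHD hI).surjective a
  rw [RingHom.comp_apply, prodFstCharacter_apply]
  have h := RingHom.congr_fun hτ (fstAlg A B z)
  rwa [RingHom.comp_apply] at h

/-- A real `τ` gives a real `prodSndCharacter τ`. [cite: Hazama1983, §3 (p. 305)] -/
theorem prodSndCharacter_isReal (hHD : exists_isReal_hodgeModel) (hI : hodgePQ_independent_of_hodgeModel)
    (hc : ∀ x y : (A.prod B).endAlgebra, x * y = y * x) {τ : B.endAlgebra →+* ℂ}
    (hτ : (starRingEnd ℂ).comp τ = τ) :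
    (starRingEnd ℂ).comp (prodSndCharacter A B hHD hI hc τ) = prodSndCharacter A B hHD hI hc τ := by
  ext a
  obtain ⟨z, rfl⟩ := (endAlgebraAlgEquivEndAlgOfComm hc hHD hI).surjective a
  rw [RingHom.comp_apply, prodSndCharacter_apply]
  have h := RingHom.congr_fun hτ (sndAlg A B z)
  rwa [RingHom.comp_apply] at h

/-- The action of `z ∈ End⁰(A × B)` (commutative) on `pr₁^* v`: `z^*(pr₁^* v) = pr₁^*((corner₁ z)^* v)`.
[cite: Deligne1982HodgeCycles, §4 p. 30] -/
theorem unop_bettiRep_baseChange_pullFst (hc : ∀ x y : (A.prod B).endAlgebra, x * y = y * x)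
    (z : (A.prod B).endAlgebra) (v : ℂ ⊗[ℚ] bettiCohomology A.X 1) :
    (MulOpposite.unop (bettiRep (A.prod B) z)).baseChange ℂ ((pullFst A B).baseChange ℂ v) =
      (pullFst A B).baseChange ℂ ((MulOpposite.unop (bettiRep A (fstAlg A B z))).baseChange ℂ v) := by
  conv_lhs => rw [NoTypeIVFactorProducts.eq_prodEndAlgebraHom_of_mem_center (mem_center_of_comm hc z)]
  rw [prodEndAlgebraHom_apply, prodEndAlgebraMap_apply, map_add, MulOpposite.unop_add, LinearMap.baseChange_add,
    LinearMap.add_apply, unop_bettiRep_inlAlg_baseChange_pullFst, unop_bettiRep_inrAlg_baseChange_pullFst, add_zero]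

/-- The action of `z ∈ End⁰(A × B)` (commutative) on `pr₂^* w`: `z^*(pr₂^* w) = pr₂^*((corner₂ z)^* w)`.
[cite: Deligne1982HodgeCycles, §4 p. 30] -/
theorem unop_bettiRep_baseChange_pullSnd (hc : ∀ x y : (A.prod B).endAlgebra, x * y = y * x)
    (z : (A.prod B).endAlgebra) (w : ℂ ⊗[ℚ] bettiCohomology B.X 1) :
    (MulOpposite.unop (bettiRep (A.prod B) z)).baseChange ℂ ((pullSnd A B).baseChange ℂ w) =
      (pullSnd A B).baseChange ℂ ((MulOpposite.unop (bettiRep B (sndAlg A B z))).baseChange ℂ w) := by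
  conv_lhs => rw [NoTypeIVFactorProducts.eq_prodEndAlgebraHom_of_mem_center (mem_center_of_comm hc z)]
  rw [prodEndAlgebraHom_apply, prodEndAlgebraMap_apply, map_add, MulOpposite.unop_add, LinearMap.baseChange_add,
    LinearMap.add_apply, unop_bettiRep_inlAlg_baseChange_pullSnd, unop_bettiRep_inrAlg_baseChange_pullSnd, zero_add]

/-- `(inlAlg 1)^* = pr₁^* ι₁^*` (complexified, applied). [cite: Lange2023AbelianVarietiesC, Cor. 2.4.26] -/
theorem unop_bettiRep_inlAlg_one_baseChange (v : ℂ ⊗[ℚ] bettiCohomology (A.prod B).X 1) :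
    (MulOpposite.unop (bettiRep (A.prod B) (inlAlg A B 1))).baseChange ℂ v =
      (pullFst A B).baseChange ℂ ((pullInl A B).baseChange ℂ v) := by
  rw [unop_bettiRep_inlAlg, map_one, MulOpposite.unop_one, Module.End.one_eq_id, LinearMap.id_comp,
    LinearMap.baseChange_comp, LinearMap.comp_apply]

/-- `(inrAlg 1)^* = pr₂^* ι₂^*` (complexified, applied). [cite: Lange2023AbelianVarietiesC, Cor. 2.4.26] -/
theorem unop_bettiRep_inrAlg_one_baseChange (v : ℂ ⊗[ℚ] bettiCohomology (A.prod B).X 1) :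
    (MulOpposite.unop (bettiRep (A.prod B) (inrAlg A B 1))).baseChange ℂ v =
      (pullSnd A B).baseChange ℂ ((pullInr A B).baseChange ℂ v) := by
  rw [unop_bettiRep_inrAlg, map_one, MulOpposite.unop_one, Module.End.one_eq_id, LinearMap.id_comp,
    LinearMap.baseChange_comp, LinearMap.comp_apply]

/-- **The eigenblock of `prodFstCharacter τ` is `pr₁^*(V_τ(A))`**, `V_τ(A) = {v ∈ H¹(A) ⊗ ℂ | e^* v = τ(e) v ∀ e}`
the joint eigenspace of `End⁰(A)` («`e ∈ E` acts on `H¹_{B,σ}` as `σ(e)`», Deligne §4; transported through the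
first Künneth summand: on `pr₁^* V_τ(A)` the element `z` acts by `τ(corner₁ z)`, and an eigenvector `x` of
`prodFstCharacter τ` satisfies `x = (inlAlg 1)^* x = pr₁^* ι₁^* x`). [cite: Deligne1982HodgeCycles, §4 p. 30]
[cite: Hazama1983, §3 (p. 305)] -/
theorem eigenBlock_prodFstCharacter (hHD : exists_isReal_hodgeModel) (hI : hodgePQ_independent_of_hodgeModel)
    (hc : ∀ x y : (A.prod B).endAlgebra, x * y = y * x)
    (τ : A.endAlgebra →+* ℂ) :
    (BettiUniverse.hodge hHD (AbelianVariety.isSmoothProjective_holds (A := A.prod B)) 1).eigenBlock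
        (prodFstCharacter A B hHD hI hc τ) =
      (⨅ e : A.endAlgebra, Module.End.eigenspace ((MulOpposite.unop (bettiRep A e)).baseChange ℂ) (τ e)).map
        ((pullFst A B).baseChange ℂ) := by
  ext x
  rw [mem_eigenBlock_iff, Submodule.mem_map]
  constructor
  · intro hx
    -- `x = pr₁^* ι₁^* x`
    have h1 := hx (endAlgebraAlgEquivEndAlgOfComm hc hHD hI (inlAlg A B 1))
    rw [prodFstCharacter_apply, fstAlg_inlAlg, show τ 1 = 1 from map_one τ, one_smul,
      coe_endAlgebraAlgEquivEndAlgOfComm_apply, unop_bettiRep_inlAlg_one_baseChange] at h1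
    refine ⟨(pullInl A B).baseChange ℂ x, ?_, h1⟩
    rw [Submodule.mem_iInf]
    intro e
    rw [Module.End.mem_eigenspace_iff]
    apply pullFst_baseChange_injective
    have h2 := hx (endAlgebraAlgEquivEndAlgOfComm hc hHD hI (inlAlg A B e))
    rw [prodFstCharacter_apply, fstAlg_inlAlg, coe_endAlgebraAlgEquivEndAlgOfComm_apply, ← h1,
      unop_bettiRep_inlAlg_baseChange_pullFst] at h2
    rw [h2, map_smul]
  · rintro ⟨v, hv, rfl⟩ a
    obtain ⟨z, rfl⟩ := (endAlgebraAlgEquivEndAlgOfComm hc hHD hI).surjective a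
    rw [prodFstCharacter_apply, coe_endAlgebraAlgEquivEndAlgOfComm_apply, unop_bettiRep_baseChange_pullFst hc,
      ← map_smul]
    congr 1
    rw [Submodule.mem_iInf] at hv
    exact Module.End.mem_eigenspace_iff.1 (hv (fstAlg A B z))

/-- **The eigenblock of `prodSndCharacter τ` is `pr₂^*(V_τ(B))`.** [cite: Deligne1982HodgeCycles, §4 p. 30]
[cite: Hazama1983, §3 (p. 305)] -/
theorem eigenBlock_prodSndCharacter (hHD : exists_isReal_hodgeModel) (hI : hodgePQ_independent_of_hodgeModel)
    (hc : ∀ x y : (A.prod B).endAlgebra, x * y = y * x)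
    (τ : B.endAlgebra →+* ℂ) :
    (BettiUniverse.hodge hHD (AbelianVariety.isSmoothProjective_holds (A := A.prod B)) 1).eigenBlock
        (prodSndCharacter A B hHD hI hc τ) =
      (⨅ e : B.endAlgebra, Module.End.eigenspace ((MulOpposite.unop (bettiRep B e)).baseChange ℂ) (τ e)).map
        ((pullSnd A B).baseChange ℂ) := by
  ext x
  rw [mem_eigenBlock_iff, Submodule.mem_map]
  constructor
  · intro hx
    have h1 := hx (endAlgebraAlgEquivEndAlgOfComm hc hHD hI (inrAlg A B 1))
    rw [prodSndCharacter_apply, sndAlg_inrAlg, show τ 1 = 1 from map_one τ, one_smul,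
      coe_endAlgebraAlgEquivEndAlgOfComm_apply, unop_bettiRep_inrAlg_one_baseChange] at h1
    refine ⟨(pullInr A B).baseChange ℂ x, ?_, h1⟩
    rw [Submodule.mem_iInf]
    intro e
    rw [Module.End.mem_eigenspace_iff]
    apply pullSnd_baseChange_injective
    have h2 := hx (endAlgebraAlgEquivEndAlgOfComm hc hHD hI (inrAlg A B e))
    rw [prodSndCharacter_apply, sndAlg_inrAlg, coe_endAlgebraAlgEquivEndAlgOfComm_apply, ← h1,
      unop_bettiRep_inrAlg_baseChange_pullSnd] at h2
    rw [h2, map_smul]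
  · rintro ⟨w, hw, rfl⟩ a
    obtain ⟨z, rfl⟩ := (endAlgebraAlgEquivEndAlgOfComm hc hHD hI).surjective a
    rw [prodSndCharacter_apply, coe_endAlgebraAlgEquivEndAlgOfComm_apply, unop_bettiRep_baseChange_pullSnd hc,
      ← map_smul]
    congr 1
    rw [Submodule.mem_iInf] at hw
    exact Module.End.mem_eigenspace_iff.1 (hw (sndAlg A B z))

/-- **`dim pr₁^*(V_τ(A)) = dim V_τ(A)`**: the eigenblock of `prodFstCharacter τ` has the dimension of the
factor's block (`pr₁^* ⊗ ℂ` is injective). [cite: Hazama1983, §3 (p. 306)] -/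
theorem finrank_eigenBlock_prodFstCharacter (hHD : exists_isReal_hodgeModel) (hI : hodgePQ_independent_of_hodgeModel)
    (hc : ∀ x y : (A.prod B).endAlgebra, x * y = y * x)
    (τ : A.endAlgebra →+* ℂ) :
    Module.finrank ℂ
        ((BettiUniverse.hodge hHD (AbelianVariety.isSmoothProjective_holds (A := A.prod B)) 1).eigenBlock
          (prodFstCharacter A B hHD hI hc τ)) =
      Module.finrank ℂ
        (⨅ e : A.endAlgebra, Module.End.eigenspace ((MulOpposite.unop (bettiRep A e)).baseChange ℂ) (τ e) :
          Submodule ℂ _) := by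
  rw [eigenBlock_prodFstCharacter]
  exact (Submodule.equivMapOfInjective _ pullFst_baseChange_injective _).finrank_eq.symm

/-- **`dim pr₂^*(V_τ(B)) = dim V_τ(B)`.** [cite: Hazama1983, §3 (p. 306)] -/
theorem finrank_eigenBlock_prodSndCharacter (hHD : exists_isReal_hodgeModel) (hI : hodgePQ_independent_of_hodgeModel)
    (hc : ∀ x y : (A.prod B).endAlgebra, x * y = y * x)
    (τ : B.endAlgebra →+* ℂ) :
    Module.finrank ℂ
        ((BettiUniverse.hodge hHD (AbelianVariety.isSmoothProjective_holds (A := A.prod B)) 1).eigenBlock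
          (prodSndCharacter A B hHD hI hc τ)) =
      Module.finrank ℂ
        (⨅ e : B.endAlgebra, Module.End.eigenspace ((MulOpposite.unop (bettiRep B e)).baseChange ℂ) (τ e) :
          Submodule ℂ _) := by
  rw [eigenBlock_prodSndCharacter]
  exact (Submodule.equivMapOfInjective _ pullSnd_baseChange_injective _).finrank_eq.symm

/-! ### §5 `H¹(A × B) ⊗ ℂ = ⊕_i pr₁^* V_{τ₁ i}(A) ⊕ ⊕_j pr₂^* V_{τ₂ j}(B)` -/

variable (A B) in
/-- The family of characters of `End_Hdg(H¹(A × B))` indexed by `ι₁ ⊕ ι₂`, from families of characters of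
`End⁰(A)`, `End⁰(B)`. [cite: Deligne1982HodgeCycles, §4 p. 30] -/
def prodCharacter (hHD : exists_isReal_hodgeModel) (hI : hodgePQ_independent_of_hodgeModel)
    (hc : ∀ x y : (A.prod B).endAlgebra, x * y = y * x) {ι₁ ι₂ : Type*}
    (τ₁ : ι₁ → (A.endAlgebra →+* ℂ)) (τ₂ : ι₂ → (B.endAlgebra →+* ℂ)) :
    ι₁ ⊕ ι₂ → ((BettiUniverse.hodge hHD (AbelianVariety.isSmoothProjective_holds (A := A.prod B)) 1).endAlg →+* ℂ) :=
  Sum.elim (fun i => prodFstCharacter A B hHD hI hc (τ₁ i)) (fun j => prodSndCharacter A B hHD hI hc (τ₂ j))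

/-- Unfolding on `inl`. [cite: Deligne1982HodgeCycles, §4 p. 30] -/
@[simp]
theorem prodCharacter_inl (hHD : exists_isReal_hodgeModel) (hI : hodgePQ_independent_of_hodgeModel)
    (hc : ∀ x y : (A.prod B).endAlgebra, x * y = y * x) {ι₁ ι₂ : Type*}
    (τ₁ : ι₁ → (A.endAlgebra →+* ℂ)) (τ₂ : ι₂ → (B.endAlgebra →+* ℂ)) (i : ι₁) :
    prodCharacter A B hHD hI hc τ₁ τ₂ (Sum.inl i) = prodFstCharacter A B hHD hI hc (τ₁ i) := rfl

/-- Unfolding on `inr`. [cite: Deligne1982HodgeCycles, §4 p. 30] -/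
@[simp]
theorem prodCharacter_inr (hHD : exists_isReal_hodgeModel) (hI : hodgePQ_independent_of_hodgeModel)
    (hc : ∀ x y : (A.prod B).endAlgebra, x * y = y * x) {ι₁ ι₂ : Type*}
    (τ₁ : ι₁ → (A.endAlgebra →+* ℂ)) (τ₂ : ι₂ → (B.endAlgebra →+* ℂ)) (j : ι₂) :
    prodCharacter A B hHD hI hc τ₁ τ₂ (Sum.inr j) = prodSndCharacter A B hHD hI hc (τ₂ j) := rfl

/-- The characters `prodCharacter` are real when the `τ₁ i`, `τ₂ j` are. [cite: Hazama1983, §3 (p. 305)] -/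
theorem prodCharacter_isReal (hHD : exists_isReal_hodgeModel) (hI : hodgePQ_independent_of_hodgeModel)
    (hc : ∀ x y : (A.prod B).endAlgebra, x * y = y * x) {ι₁ ι₂ : Type*}
    {τ₁ : ι₁ → (A.endAlgebra →+* ℂ)} {τ₂ : ι₂ → (B.endAlgebra →+* ℂ)}
    (h₁ : ∀ i, (starRingEnd ℂ).comp (τ₁ i) = τ₁ i) (h₂ : ∀ j, (starRingEnd ℂ).comp (τ₂ j) = τ₂ j)
    (k : ι₁ ⊕ ι₂) :
    (starRingEnd ℂ).comp (prodCharacter A B hHD hI hc τ₁ τ₂ k) = prodCharacter A B hHD hI hc τ₁ τ₂ k := by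
  cases k with
  | inl i => exact prodFstCharacter_isReal hHD hI hc (h₁ i)
  | inr j => exact prodSndCharacter_isReal hHD hI hc (h₂ j)

/-- **`H¹(A × B) ⊗ ℂ` is the internal direct sum of the eigenblocks of the characters `prodCharacter τ₁ τ₂`**
when `H¹(A) ⊗ ℂ = ⊕_i V_{τ₁ i}(A)` and `H¹(B) ⊗ ℂ = ⊕_j V_{τ₂ j}(B)` are internal direct sums (Hazama 1983 §3:
`H¹(A, ℂ) = V₁ ⊕ ⋯ ⊕ V_k`, for each factor; Künneth). [cite: Hazama1983, §3 (p. 305)]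
[cite: Deligne1982HodgeCycles, §4 p. 30] [cite: VoisinHodgeI2002, §11.3.3 Thm. 11.38] -/
theorem isInternal_eigenBlock_prodCharacter (hHD : exists_isReal_hodgeModel) (hI : hodgePQ_independent_of_hodgeModel)
    (hc : ∀ x y : (A.prod B).endAlgebra, x * y = y * x)
    {ι₁ ι₂ : Type*} [DecidableEq ι₁] [DecidableEq ι₂]
    {τ₁ : ι₁ → (A.endAlgebra →+* ℂ)} {τ₂ : ι₂ → (B.endAlgebra →+* ℂ)}
    (h₁ : DirectSum.IsInternal fun i =>
      (⨅ e : A.endAlgebra, Module.End.eigenspace ((MulOpposite.unop (bettiRep A e)).baseChange ℂ) (τ₁ i e) :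
        Submodule ℂ _))
    (h₂ : DirectSum.IsInternal fun j =>
      (⨅ e : B.endAlgebra, Module.End.eigenspace ((MulOpposite.unop (bettiRep B e)).baseChange ℂ) (τ₂ j e) :
        Submodule ℂ _)) :
    DirectSum.IsInternal fun k =>
      (BettiUniverse.hodge hHD (AbelianVariety.isSmoothProjective_holds (A := A.prod B)) 1).eigenBlock
        (prodCharacter A B hHD hI hc τ₁ τ₂ k) := by
  have hfun : (fun k =>
      (BettiUniverse.hodge hHD (AbelianVariety.isSmoothProjective_holds (A := A.prod B)) 1).eigenBlock
        (prodCharacter A B hHD hI hc τ₁ τ₂ k)) =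
      Sum.elim
        (fun i => (⨅ e : A.endAlgebra,
          Module.End.eigenspace ((MulOpposite.unop (bettiRep A e)).baseChange ℂ) (τ₁ i e)).map
            ((pullFst A B).baseChange ℂ))
        (fun j => (⨅ e : B.endAlgebra,
          Module.End.eigenspace ((MulOpposite.unop (bettiRep B e)).baseChange ℂ) (τ₂ j e)).map
            ((pullSnd A B).baseChange ℂ)) := by
    funext k
    cases k with
    | inl i => rw [Sum.elim_inl, prodCharacter_inl, eigenBlock_prodFstCharacter]
    | inr j => rw [Sum.elim_inr, prodCharacter_inr, eigenBlock_prodSndCharacter]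
  rw [hfun]
  exact isInternal_sum_elim_map ((pullFst A B).baseChange ℂ) ((pullSnd A B).baseChange ℂ)
    ((pullInl A B).baseChange ℂ) ((pullInr A B).baseChange ℂ) pullInl_pullFst_baseChange
    pullInl_pullSnd_baseChange pullInr_pullSnd_baseChange pullInr_pullFst_baseChange
    pullFst_pullInl_add_baseChange h₁ h₂

/-- **Each eigenblock of `prodCharacter τ₁ τ₂` is two-dimensional** when the factors' blocks are.
[cite: Hazama1983, §3 (p. 306)] -/
theorem finrank_eigenBlock_prodCharacter (hHD : exists_isReal_hodgeModel) (hI : hodgePQ_independent_of_hodgeModel)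
    (hc : ∀ x y : (A.prod B).endAlgebra, x * y = y * x)
    {ι₁ ι₂ : Type*} {τ₁ : ι₁ → (A.endAlgebra →+* ℂ)} {τ₂ : ι₂ → (B.endAlgebra →+* ℂ)} {d : ℕ}
    (h₁ : ∀ i, Module.finrank ℂ
      (⨅ e : A.endAlgebra, Module.End.eigenspace ((MulOpposite.unop (bettiRep A e)).baseChange ℂ) (τ₁ i e) :
        Submodule ℂ _) = d)
    (h₂ : ∀ j, Module.finrank ℂ
      (⨅ e : B.endAlgebra, Module.End.eigenspace ((MulOpposite.unop (bettiRep B e)).baseChange ℂ) (τ₂ j e) :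
        Submodule ℂ _) = d)
    (k : ι₁ ⊕ ι₂) :
    Module.finrank ℂ
      ((BettiUniverse.hodge hHD (AbelianVariety.isSmoothProjective_holds (A := A.prod B)) 1).eigenBlock
        (prodCharacter A B hHD hI hc τ₁ τ₂ k)) = d := by
  cases k with
  | inl i => rw [prodCharacter_inl, finrank_eigenBlock_prodFstCharacter, h₁ i]
  | inr j => rw [prodCharacter_inr, finrank_eigenBlock_prodSndCharacter, h₂ j]

end HOneProduct

end Literature.AlgebraicGeometry.HodgeTheory

end
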